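import Summits.QuantumFields.YangMills.Theorems.BalabanUVNodesN08LaunderingAbstract
import Summits.QuantumFields.YangMills.Theorems.BalabanUVNodesN08GuardReadSetIncidence

/-!
# BalabanUVNodes ∕ N08 — (M4-core) ONE ISOLATED FIRING IS INVISIBLE TWO LEVELS UP: if the level-`k` step is the straight transporter modified in the single coarse coordinate `c` by
# any map reading only the guard's read set, the weight reads only that read set, and the level-`k+1` step is the straight transporter, then the push-forward to level `k+2` is an
# EXACT multiple of product Haar — provided every level-`(k+2)` segment has an END slot not incident to `c`

Track A, DAG node N08 ([Balaban1985UV3] Thm 1 p. 257 ∕ Thm 2 p. 272; averaging [Balaban1987RG1] (0.4) p. 253; straight transporter [Balaban1984PropagatorsI] (1.7) p. 18).  Cell `pub-ymgap`,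
seat `pub-ymgap-dag-n08-d` g47 (R529-ym job; DESIGN memo (M4), SPEC memo §2–§3); `--supports stmt-QuantumFields-19936` (helper).  Built on ✓`…N08LaunderingAbstract` (the Weil core)
and ✓`…N08GuardReadSetIncidence` (`segment_unread_of_not_incident`).

THE STATEMENT.  Level-`k` fields `U ~ g·dU_k` with `g` reading only the bonds of the loop words of `c` (the firing weight: guard indicator × anything gauge-invariant local); the
level-`k` map `Hyb U := update (axialAvg U) c (m U)` with `m` measurable reading only the same bonds (the guarded branch's output at `c` — `corr·U(c)` — or ANY such modification);
the level-`(k+1)` map `axialAvg` (no firing there).  IF every straight segment `C` of level `k+2` has the target of its LAST slot or the source of its FIRST slot off `{c₋, c₊}` (the two block-centre sites `emb C₊`, `emb C₋` cannot both be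
endpoints of the unit bond `c` — NO EXCEPTION, not even the middle bond; kept as the displayed hypothesis `hslot`, a pure torus fact), THEN `(g·dU_k).map (axialAvg ∘ Hyb) =
(∫g)•dU_{k+2}`: the firing leaves NO TRACE two levels up.  Proof: the coarse right translation of `C` is realised by right-multiplying the LAST level-`k` bond of the LAST level-`(k+1)`
slot of `C` (two nested `axialAvg_mul_last`); that fine bond issues from the block `B((line C (L−1))₊)`, which the guard of `c` does not read (✓`…GuardReadSet.ne_of_blockOf_src_ne` +
`blockOf_src_line_last`), so `g` and `m` are fixed; left twin with the first fine bond of the first slot; then ✓`map_withDensity_eq_smul_of_translations`.  (px8 g12's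
`UV3AxialLaunderingTwoLevelSingleFiring` is the slot-parametric twin over the Tonelli core; this is the END-slot instance over the Weil core, with the incidence hypothesis in its
weakest — always satisfiable — form.)

CONTENTS ([folklore] over the tree's objects; 0 `def`, 0 `sorry`): `extend_last_apply_eq_one_of_read` ∕ `extend_first_apply_eq_one_of_read` (the nested end-bond translations do not touch
read bonds), ★ `avgFun_eq_of_not_incident` (the GUARDED average of a non-incident bond does not feel `c`'s read set either — ref-G READ603 (2)), ★★★ `map_withDensity_axialAvg_update_eq_smul` (the theorem).
HONEST: count-neutral helper — ONE isolated firing, pure axial step above it; the polymer expansion (M5)(M6) is not here; hTop ∕ (a)′∀ ∕ hJ NOT proved; N08 NOT discharged;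
R3 ≠ d = 4 ∕ mass gap ∕ Clay.
-/

noncomputable section

open MeasureTheory
open scoped ENNReal

namespace Summit.QuantumFields.YangMills.Theorems.BalabanUVNodesN08TwoLevelInvisibleFiring

open Literature.MathematicalPhysics.QuantumFieldTheory.Balaban1983to89
open Literature.MathematicalPhysics.QuantumFieldTheory.Balaban1983to89.T4Continuum
open Literature.MathematicalPhysics.QuantumFieldTheory.Balaban1983to89.AveragingRT
open Literature.MathematicalPhysics.QuantumFieldTheory.Balaban1983to89.BlockAveraging
open Summit.QuantumFields.YangMills.Theorems.BalabanUVNodesN08AxialLaunderingFirstBond (first_injective axialAvg_mul_first)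
open Summit.QuantumFields.YangMills.Theorems.BalabanUVNodesN08GuardReadSetIncidence (segment_unread_of_not_incident)
open Summit.QuantumFields.YangMills.Theorems.BalabanUVNodesN08LaunderingAbstract (map_withDensity_eq_smul_of_translations)

variable {P : Params} {k : ℕ} {G : Type*} [GaugeGroup G]

/-! ## §1 The nested end-bond translations do not touch the bonds read by the guard of `c` -/

/-- If the coarse field `h` (level `k+1`) equals `1` at every bond whose TARGET is an endpoint of `c`, then the last-bond extension of `h` to level `k` equals `1` at every bond read by the
guard of `c` (the last fine bond of `c₁` issues from `B(c₁₊)`, read only if `c₁₊ ∈ {c₋, c₊}`). [folklore] -/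
theorem extend_last_apply_eq_one_of_read (hk : k + 1 ≤ P.m + P.K) (c : PBond P (k + 1)) (h : GaugeField P (k + 1) G)
    (hh : ∀ c₁ : PBond P (k + 1), (c₁.tgt = c.src ∨ c₁.tgt = c.tgt) → h c₁ = 1)
    (i : Idx P) (s : LStep P k) (hs : s ∈ walk (emb c.src) (loopWord P.L c.dir (off i.1) i.2.1 i.2.2)) :
    Function.extend (fun c₁ : PBond P (k + 1) => line c₁ (P.L - 1)) h (fun _ => 1) s.bond = 1 := by
  classical
  by_cases hex : ∃ c₁ : PBond P (k + 1), line c₁ (P.L - 1) = s.bond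
  · obtain ⟨c₁, hc₁⟩ := hex
    rw [← hc₁, (last_injective hk).extend_apply]
    by_contra hne
    have hninc : ¬ (c₁.tgt = c.src ∨ c₁.tgt = c.tgt) := fun hinc => hne (hh c₁ hinc)
    simp only [not_or] at hninc
    -- the LAST fine bond of `c₁` issues from the block `c₁₊`, which the guard of `c` does not read
    refine BalabanUVNodesN08GuardReadSet.ne_of_blockOf_src_ne hk c (b := line c₁ (P.L - 1)) ?_ ?_ i s hs hc₁.symm
    · rw [BalabanUVNodesN08GuardReadSet.blockOf_src_line_last hk]; exact hninc.1
    · rw [BalabanUVNodesN08GuardReadSet.blockOf_src_line_last hk]; exact hninc.2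
  · exact Function.extend_apply' _ _ _ hex

/-- First-bond twin: `h = 1` at every bond whose SOURCE is an endpoint of `c` ⇒ the first-bond extension is `1` on the read bonds. [folklore] -/
theorem extend_first_apply_eq_one_of_read (hk : k + 1 ≤ P.m + P.K) (c : PBond P (k + 1)) (h : GaugeField P (k + 1) G)
    (hh : ∀ c₁ : PBond P (k + 1), (c₁.src = c.src ∨ c₁.src = c.tgt) → h c₁ = 1)
    (i : Idx P) (s : LStep P k) (hs : s ∈ walk (emb c.src) (loopWord P.L c.dir (off i.1) i.2.1 i.2.2)) :
    Function.extend (fun c₁ : PBond P (k + 1) => line c₁ 0) h (fun _ => 1) s.bond = 1 := by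
  classical
  by_cases hex : ∃ c₁ : PBond P (k + 1), line c₁ 0 = s.bond
  · obtain ⟨c₁, hc₁⟩ := hex
    rw [← hc₁, (first_injective hk).extend_apply]
    by_contra hne
    have hninc : ¬ (c₁.src = c.src ∨ c₁.src = c.tgt) := fun hinc => hne (hh c₁ hinc)
    simp only [not_or] at hninc
    -- the FIRST fine bond of `c₁` issues from the centre block `c₁₋`, which the guard of `c` does not read
    refine BalabanUVNodesN08GuardReadSet.ne_of_blockOf_src_ne hk c (b := line c₁ 0) ?_ ?_ i s hs hc₁.symm
    · rw [BalabanUVNodesN08GuardReadSet.blockOf_src_line_zero hk]; exact hninc.1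
    · rw [BalabanUVNodesN08GuardReadSet.blockOf_src_line_zero hk]; exact hninc.2
  · exact Function.extend_apply' _ _ _ hex

/-- ★ **The GUARDED average of a non-incident bond is untouched too** (referee ref-G READ603 (2)): `avgFun ℰ U c″` reads only bonds issuing from `B(c″₋) ∪ B(c″₊)` (lit
`BlockAveraging.avgFun_local`), none of which is read by the guard of `c` when `c″` is not incident to `c`'s endpoints (✓`…GuardReadSet.ne_of_blockOf_src_ne`): so if `U, U′` agree
off the bonds read by `c`, then `avgFun ℰ U c″ = avgFun ℰ U′ c″` — other firings at the SAME level at non-incident bonds do not interact with the one at `c`. [cite: Balaban1987RG1, (0.4) p.253] -/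
theorem avgFun_eq_of_not_incident (hk : k + 1 ≤ P.m + P.K) (ℰ : LoopAverage G) {U U' : GaugeField P k G} (c c'' : PBond P (k + 1))
    (hs : c''.src ≠ c.src ∧ c''.src ≠ c.tgt) (ht : c''.tgt ≠ c.src ∧ c''.tgt ≠ c.tgt)
    (hUU' : ∀ b : PBond P k, (∀ (i : Idx P), ∀ s ∈ walk (emb c.src) (loopWord P.L c.dir (off i.1) i.2.1 i.2.2), s.bond ≠ b) → U b = U' b) :
    avgFun ℰ U c'' = avgFun ℰ U' c'' := by
  refine avgFun_local ℰ hk U U' c'' fun b hb => hUU' b ?_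
  refine BalabanUVNodesN08GuardReadSet.ne_of_blockOf_src_ne hk c ?_ ?_
  · rcases hb with h | h
    · rw [h]; exact hs.1
    · rw [h]; exact ht.1
  · rcases hb with h | h
    · rw [h]; exact hs.2
    · rw [h]; exact ht.2

/-! ## §2 The two-level invisibility theorem -/

variable [MeasurableSpace G] [HaarData G] [MeasurableMul₂ G] [MeasurableInv G]

/-- ★★★ **ONE ISOLATED FIRING IS INVISIBLE TWO LEVELS UP.**  Standing range at both levels (`k+1 ≤ m+K`, `k+2 ≤ m+K`); `c` the fired coarse bond; `m : GaugeField P k G → G` measurable and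
`g : GaugeField P k G → ℝ≥0∞` measurable with finite integral, BOTH READING ONLY the bonds of the loop words of `c`; the level-`k` map `U ↦ update (axialAvg U) c (m U)`, the
level-`(k+1)` map `axialAvg`.  If every level-`(k+2)` segment `C` has the TARGET of its last slot `line C (L−1)`, or the SOURCE of its first slot `line C 0`, off the endpoints of
`c` (these are the centre sites `emb C₊`, `emb C₋` — always true in the standing range, see the SPEC; kept as the hypothesis `hslot` here), then
`((dU_k).withDensity g).map (fun U ↦ axialAvg (update (axialAvg U) c (m U))) = (∫⁻ g dU_k) • dU_{k+2}`. [cite: Balaban1987RG1, (0.4) p.253; Balaban1984PropagatorsI, (1.7) p.18] -/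
theorem map_withDensity_axialAvg_update_eq_smul [DecidableEq (PBond P (k + 1))] (hk : k + 1 ≤ P.m + P.K) (hk1 : k + 1 + 1 ≤ P.m + P.K) (c : PBond P (k + 1))
    {m : GaugeField P k G → G} (hm : Measurable m)
    (hm_read : ∀ U U' : GaugeField P k G,
      (∀ (i : Idx P), ∀ s ∈ walk (emb c.src) (loopWord P.L c.dir (off i.1) i.2.1 i.2.2), U s.bond = U' s.bond) → m U = m U')
    {g : GaugeField P k G → ℝ≥0∞} (hg : Measurable g) (hgfin : ∫⁻ U, g U ∂(fieldMeasure P k G) ≠ ∞)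
    (hg_read : ∀ U U' : GaugeField P k G,
      (∀ (i : Idx P), ∀ s ∈ walk (emb c.src) (loopWord P.L c.dir (off i.1) i.2.1 i.2.2), U s.bond = U' s.bond) → g U = g U')
    (hslot : ∀ C : PBond P (k + 1 + 1),
      (¬ ((line C (P.L - 1)).tgt = c.src ∨ (line C (P.L - 1)).tgt = c.tgt)) ∨ (¬ ((line C 0).src = c.src ∨ (line C 0).src = c.tgt))) :
    ((fieldMeasure P k G).withDensity g).map
        (fun U : GaugeField P k G => (axialAvg (Function.update (axialAvg U) c (m U)) : GaugeField P (k + 1 + 1) G)) =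
      (∫⁻ U, g U ∂(fieldMeasure P k G)) • fieldMeasure P (k + 1 + 1) G := by
  -- target ∕ source incidence predicates, as local abbreviations inside the proof
  set IncT : PBond P (k + 1) → Prop := fun c₁ => c₁.tgt = c.src ∨ c₁.tgt = c.tgt with hIncT
  set IncS : PBond P (k + 1) → Prop := fun c₁ => c₁.src = c.src ∨ c₁.src = c.tgt with hIncS
  have hIncT_c : IncT c := Or.inr rfl
  have hIncS_c : IncS c := Or.inl rfl
  -- measurability of the two-level map
  have hHyb : Measurable (fun U : GaugeField P k G => Function.update (axialAvg U) c (m U)) := by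
    refine measurable_pi_iff.mpr fun c₁ => ?_
    by_cases hc : c₁ = c
    · subst hc; simp only [Function.update_self]; exact hm
    · simp only [Function.update_of_ne hc]; exact (measurable_pi_iff.mp measurable_axialAvg) c₁
  have hΦ : Measurable (fun U : GaugeField P k G => (axialAvg (Function.update (axialAvg U) c (m U)) : GaugeField P (k + 1 + 1) G)) :=
    measurable_axialAvg.comp hHyb
  refine map_withDensity_eq_smul_of_translations (G := G) (fieldMeasure P k G) {C : PBond P (k + 1 + 1) | ¬ IncT (line C (P.L - 1))} hg hgfin hΦ ?_ ?_
  · -- RIGHT translations on `T = {C | last slot not incident}`: right-multiply the last level-k bond of the last slot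
    intro h hh
    -- the level-(k+1) field of translations of the last slots, and its level-k extension
    set h' : GaugeField P (k + 1) G := Function.extend (fun C : PBond P (k + 1 + 1) => line C (P.L - 1)) h (fun _ => 1) with hh'
    have hh'1 : ∀ c₁ : PBond P (k + 1), IncT c₁ → h' c₁ = 1 := by
      intro c₁ hinc
      by_cases hex : ∃ C : PBond P (k + 1 + 1), line C (P.L - 1) = c₁
      · obtain ⟨C, rfl⟩ := hex
        rw [hh', (last_injective hk1).extend_apply]
        by_cases hC : C ∈ {C : PBond P (k + 1 + 1) | ¬ IncT (line C (P.L - 1))}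
        · exact absurd hinc hC
        · exact hh C hC
      · rw [hh', Function.extend_apply' _ _ _ hex]
    refine ⟨fun U b => U b * Function.extend (fun c₁ : PBond P (k + 1) => line c₁ (P.L - 1)) h' (fun _ => 1) b, measurePreserving_mulRight _, ?_, ?_⟩
    · -- `g` is fixed: the translation is `1` on the read bonds
      intro U
      exact hg_read _ _ fun i s hs => by
        show U s.bond * _ = U s.bond
        rw [extend_last_apply_eq_one_of_read hk c h' hh'1 i s hs, mul_one]
    · intro U
      have hmU : m (fun b => U b * Function.extend (fun c₁ : PBond P (k + 1) => line c₁ (P.L - 1)) h' (fun _ => 1) b) = m U :=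
        hm_read _ _ fun i s hs => by
          show U s.bond * _ = U s.bond
          rw [extend_last_apply_eq_one_of_read hk c h' hh'1 i s hs, mul_one]
      have hstep : Function.update (axialAvg fun b => U b * Function.extend (fun c₁ : PBond P (k + 1) => line c₁ (P.L - 1)) h' (fun _ => 1) b) c
            (m fun b => U b * Function.extend (fun c₁ : PBond P (k + 1) => line c₁ (P.L - 1)) h' (fun _ => 1) b)
          = fun c₁ => Function.update (axialAvg U) c (m U) c₁ * Function.extend (fun C : PBond P (k + 1 + 1) => line C (P.L - 1)) h (fun _ => 1) c₁ := by
        rw [axialAvg_mul_last hk, hmU]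
        funext c₁
        by_cases hc : c₁ = c
        · subst hc
          rw [Function.update_self, Function.update_self]
          show m U = m U * h' c₁
          rw [hh'1 c₁ hIncT_c, mul_one]
        · rw [Function.update_of_ne hc, Function.update_of_ne hc]
      show axialAvg _ = fun C => axialAvg (Function.update (axialAvg U) c (m U)) C * h C
      rw [hstep, axialAvg_mul_last hk1]
  · -- LEFT translations off `T`: there the FIRST slot is not incident; left-multiply the first level-k bond of the first slot
    intro h hh
    set h' : GaugeField P (k + 1) G := Function.extend (fun C : PBond P (k + 1 + 1) => line C 0) h (fun _ => 1) with hh'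
    have hh'1 : ∀ c₁ : PBond P (k + 1), IncS c₁ → h' c₁ = 1 := by
      intro c₁ hinc
      by_cases hex : ∃ C : PBond P (k + 1 + 1), line C 0 = c₁
      · obtain ⟨C, rfl⟩ := hex
        rw [hh', (first_injective hk1).extend_apply]
        by_cases hC : C ∈ {C : PBond P (k + 1 + 1) | ¬ IncT (line C (P.L - 1))}
        · exact hh C hC
        · rcases hslot C with h1 | h1
          · exact absurd h1 hC
          · exact absurd hinc h1
      · rw [hh', Function.extend_apply' _ _ _ hex]
    refine ⟨fun U b => Function.extend (fun c₁ : PBond P (k + 1) => line c₁ 0) h' (fun _ => 1) b * U b, measurePreserving_mulLeft _, ?_, ?_⟩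
    · intro U
      exact hg_read _ _ fun i s hs => by
        show _ * U s.bond = U s.bond
        rw [extend_first_apply_eq_one_of_read hk c h' hh'1 i s hs, one_mul]
    · intro U
      have hmU : m (fun b => Function.extend (fun c₁ : PBond P (k + 1) => line c₁ 0) h' (fun _ => 1) b * U b) = m U :=
        hm_read _ _ fun i s hs => by
          show _ * U s.bond = U s.bond
          rw [extend_first_apply_eq_one_of_read hk c h' hh'1 i s hs, one_mul]
      have hstep : Function.update (axialAvg fun b => Function.extend (fun c₁ : PBond P (k + 1) => line c₁ 0) h' (fun _ => 1) b * U b) c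
            (m fun b => Function.extend (fun c₁ : PBond P (k + 1) => line c₁ 0) h' (fun _ => 1) b * U b)
          = fun c₁ => Function.extend (fun C : PBond P (k + 1 + 1) => line C 0) h (fun _ => 1) c₁ * Function.update (axialAvg U) c (m U) c₁ := by
        rw [axialAvg_mul_first hk, hmU]
        funext c₁
        by_cases hc : c₁ = c
        · subst hc
          rw [Function.update_self, Function.update_self]
          show m U = h' c₁ * m U
          rw [hh'1 c₁ hIncS_c, one_mul]
        · rw [Function.update_of_ne hc, Function.update_of_ne hc]
      show axialAvg _ = fun C => h C * axialAvg (Function.update (axialAvg U) c (m U)) C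
      rw [hstep, axialAvg_mul_first hk1]

/-! ## §3 The slot hypothesis is a torus fact: the unconditional form -/

omit [MeasurableSpace G] [HaarData G] [MeasurableMul₂ G] [MeasurableInv G] in
/-- **`L` is neither `0`, `1` nor `−1` modulo the number of sites per direction one level down** (standing range: `N_{k+1} = N_{k+2}·L ≥ 2L`, `L ≥ 3`). [folklore] -/
theorem natCast_L_ne (hk1 : k + 1 + 1 ≤ P.m + P.K) :
    ((P.L : ℕ) : ZMod (P.sitesPerDir (k + 1))) ≠ 0 ∧ ((P.L : ℕ) : ZMod (P.sitesPerDir (k + 1))) ≠ 1 ∧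
      ((P.L : ℕ) : ZMod (P.sitesPerDir (k + 1))) + 1 ≠ 0 := by
  have hL := P.hL.2
  have hN2 : 1 < P.sitesPerDir (k + 1 + 1) := P.one_lt_sitesPerDir (k + 1 + 1)
  have hN : P.sitesPerDir (k + 1) = P.sitesPerDir (k + 1 + 1) * P.L := P.sitesPerDir_eq_mul_succ hk1
  have hNL : 2 * P.L ≤ P.sitesPerDir (k + 1) := by rw [hN]; nlinarith
  refine ⟨?_, ?_, ?_⟩
  · rw [Ne, ZMod.natCast_eq_zero_iff]
    intro h; have := Nat.le_of_dvd (by omega) h; omega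
  · rw [Ne, show (1 : ZMod (P.sitesPerDir (k + 1))) = ((1 : ℕ) : ZMod (P.sitesPerDir (k + 1))) by norm_num,
      ZMod.natCast_eq_natCast_iff', Nat.mod_eq_of_lt (by omega : P.L < P.sitesPerDir (k + 1)),
      Nat.mod_eq_of_lt (by omega : 1 < P.sitesPerDir (k + 1))]
    omega
  · rw [Ne, show ((P.L : ℕ) : ZMod (P.sitesPerDir (k + 1))) + 1 = ((P.L + 1 : ℕ) : ZMod (P.sitesPerDir (k + 1))) by push_cast; ring,
      ZMod.natCast_eq_zero_iff]
    intro h; have := Nat.le_of_dvd (by omega) h; omega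

omit [MeasurableSpace G] [HaarData G] [MeasurableMul₂ G] [MeasurableInv G] in
/-- ★★ **THE SLOT HYPOTHESIS HOLDS FOR EVERY SEGMENT**: the target of the last slot of `C` is `emb C₊ = emb C₋ + L e_{C.dir}` and the source of its first slot is `emb C₋`; these two
sites, `L` apart in one coordinate, cannot BOTH be endpoints of the unit bond `c` (that would force `L ≡ 0, 1` or `−1` modulo `sitesPerDir (k+1) ≥ 2L`). [folklore] -/
theorem last_tgt_or_first_src_off (hk1 : k + 1 + 1 ≤ P.m + P.K) (c : PBond P (k + 1)) (C : PBond P (k + 1 + 1)) :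
    (¬ ((line C (P.L - 1)).tgt = c.src ∨ (line C (P.L - 1)).tgt = c.tgt)) ∨ (¬ ((line C 0).src = c.src ∨ (line C 0).src = c.tgt)) := by
  obtain ⟨hL0, hL1, hLm1⟩ := natCast_L_ne (P := P) hk1
  have hL := P.hL.2
  -- the two sites
  have hfirst : (line C 0).src = emb C.src := lineSite_zero C
  have hlast : (line C (P.L - 1)).tgt = Function.update (emb C.src) C.dir (emb C.src C.dir + (P.L : ℕ)) := by
    show (lineSite C (P.L - 1)).shift C.dir = _
    rw [← lineSite_succ, show P.L - 1 + 1 = P.L by omega]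
    rfl
  by_contra hboth
  rw [not_or, not_not, not_not] at hboth
  obtain ⟨h1, h2⟩ := hboth
  rw [hlast] at h1
  rw [hfirst] at h2
  set a : Site P (k + 1) := emb C.src with ha
  have htgt : c.tgt = Function.update c.src c.dir (c.src c.dir + 1) := rfl
  -- evaluate everything at the coordinate `C.dir`
  rcases h2 with h2 | h2 <;> rcases h1 with h1 | h1
  · -- a = c₋, b = c₋
    have := congrFun h1 C.dir
    rw [Function.update_self, ← h2] at this
    exact hL0 (by simpa using this)
  · -- a = c₋, b = c₊
    have e := congrFun h1 C.dir
    rw [Function.update_self, htgt, ← h2] at e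
    by_cases hd : C.dir = c.dir
    · rw [hd, Function.update_self] at e
      exact hL1 (by simpa using e)
    · rw [Function.update_of_ne hd] at e
      exact hL0 (by simpa using e)
  · -- a = c₊, b = c₋ : then `c₋ (C.dir) = a (C.dir) + L` and `a = c₊`
    have e := congrFun h1 C.dir
    rw [Function.update_self, h2, htgt] at e
    by_cases hd : C.dir = c.dir
    · rw [hd, Function.update_self] at e
      -- e : c.src c.dir + 1 + L = c.src c.dir
      apply hLm1
      have : ((P.L : ℕ) : ZMod (P.sitesPerDir (k + 1))) + 1 = (c.src c.dir + 1 + (P.L : ℕ)) - c.src c.dir := by ring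
      rw [this, e, sub_self]
    · rw [Function.update_of_ne hd] at e
      exact hL0 (by simpa using e)
  · -- a = c₊, b = c₊
    have := congrFun h1 C.dir
    rw [Function.update_self, ← h2] at this
    exact hL0 (by simpa using this)

/-- ★★★ **ONE ISOLATED FIRING IS INVISIBLE TWO LEVELS UP — UNCONDITIONALLY IN THE SLOTS**: as `map_withDensity_axialAvg_update_eq_smul`, the incidence hypothesis discharged by
`last_tgt_or_first_src_off`; the only hypotheses left are the standing range and that `m`, `g` read only the bonds of the loop words of `c`. [cite: Balaban1987RG1, (0.4) p.253] -/
theorem map_withDensity_axialAvg_update_eq_smul' [DecidableEq (PBond P (k + 1))] (hk : k + 1 ≤ P.m + P.K) (hk1 : k + 1 + 1 ≤ P.m + P.K) (c : PBond P (k + 1))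
    {m : GaugeField P k G → G} (hm : Measurable m)
    (hm_read : ∀ U U' : GaugeField P k G,
      (∀ (i : Idx P), ∀ s ∈ walk (emb c.src) (loopWord P.L c.dir (off i.1) i.2.1 i.2.2), U s.bond = U' s.bond) → m U = m U')
    {g : GaugeField P k G → ℝ≥0∞} (hg : Measurable g) (hgfin : ∫⁻ U, g U ∂(fieldMeasure P k G) ≠ ∞)
    (hg_read : ∀ U U' : GaugeField P k G,
      (∀ (i : Idx P), ∀ s ∈ walk (emb c.src) (loopWord P.L c.dir (off i.1) i.2.1 i.2.2), U s.bond = U' s.bond) → g U = g U') :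
    ((fieldMeasure P k G).withDensity g).map
        (fun U : GaugeField P k G => (axialAvg (Function.update (axialAvg U) c (m U)) : GaugeField P (k + 1 + 1) G)) =
      (∫⁻ U, g U ∂(fieldMeasure P k G)) • fieldMeasure P (k + 1 + 1) G :=
  map_withDensity_axialAvg_update_eq_smul hk hk1 c hm hm_read hg hgfin hg_read (last_tgt_or_first_src_off hk1 c)

end Summit.QuantumFields.YangMills.Theorems.BalabanUVNodesN08TwoLevelInvisibleFiring

end
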